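import Mathlib
import HarnessLib
import Summits.ValiantsHypothesis.ValiantsHypothesis.Theses.MonotoneRestoration
import Literature.Computability.AlgebraicComplexity.ArithCircuit
import Literature.Computability.AlgebraicComplexity.ArithCircuitProofs
import Literature.Computability.AlgebraicComplexity.MonotoneStructure
import Literature.Computability.AlgebraicComplexity.PermanentIrreducible
import Literature.ModelTheory.FiniteModelTheory.CkEquiv
import Summits.ValiantsHypothesis.ValiantsHypothesis.Theorems.MonotoneRestorationMonotoneRestorationQPCosetCount
import Summits.ValiantsHypothesis.ValiantsHypothesis.Theorems.MonotoneRestorationMonotoneRestorationQPSymmetricLB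
import Summits.ValiantsHypothesis.ValiantsHypothesis.Theorems.MonotoneRestorationMonotoneRestorationQPSupportSymmetrisation
import Summits.ValiantsHypothesis.ValiantsHypothesis.Theorems.MonotoneRestorationMonotoneRestorationQPSparseRegime
import Summits.ValiantsHypothesis.ValiantsHypothesis.Theorems.MonotoneRestorationMonotoneRestorationQPBeta
import Literature.Computability.AlgebraicComplexity.SymmetricArithCircuit
import Literature.Computability.AlgebraicComplexity.DawarWilsenach2025Proofs
import Literature.GroupTheory.PermutationGroups.SmallIndexSubgroups
import Summits.ValiantsHypothesis.ValiantsHypothesis.Theorems.MonotoneRestorationQP.Negative.LoadBearing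
import Summits.ValiantsHypothesis.ValiantsHypothesis.Theorems.MonotoneRestorationMonotoneRestorationQPPermSupportCount

/-! TTRL-lite variant V19202 of stmt-ValiantsHypothesis-15886 -/

-- `Summit.ValiantsHypothesis.ValiantsHypothesis.…` is the tree's mandated single-conjunct layout
-- (Sub = Summit), so the duplicated namespace component is intended.
set_option linter.dupNamespace false

namespace Summit.ValiantsHypothesis.ValiantsHypothesis.Theorems

open Summit.ValiantsHypothesis.ValiantsHypothesis.Theses.MonotoneRestoration
open Literature.Computability.AlgebraicComplexity

open scoped Pointwise in
/-- TTRL-lite variant V19202 of `stub_esymmRowSums_structure` (stmt-ValiantsHypothesis-15886):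
every monomial of `(∑ j, X (a, j)) * q` is `single (a, j) 1 + m'` for some `j` and some
monomial `m'` of `q` (support of a product lies in the Minkowski sum of the supports, and the
support of a sum of variables is the set of the corresponding unit vectors). -/
theorem stub_esymmRowSums_structure_var19202 :
    ∀ (n : ℕ) (a : Fin n) (q : MvPolynomial (Fin n × Fin n) NNReal) (m : Fin n × Fin n →₀ ℕ),
      m ∈ ((∑ j : Fin n, MvPolynomial.X (a, j)) * q).support →
        ∃ (j : Fin n) (m' : Fin n × Fin n →₀ ℕ), m' ∈ q.support ∧
          m = Finsupp.single (a, j) 1 + m' := by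
  intro n a q m hm
  have h1 := MvPolynomial.support_mul _ _ hm
  rw [Finset.mem_add] at h1
  obtain ⟨u, hu, m', hm', rfl⟩ := h1
  have h2 := MvPolynomial.support_sum hu
  rw [Finset.mem_biUnion] at h2
  obtain ⟨j, _, hj⟩ := h2
  rw [MvPolynomial.support_X, Finset.mem_singleton] at hj
  exact ⟨j, m', hm', by rw [hj]⟩

end Summit.ValiantsHypothesis.ValiantsHypothesis.Theorems
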